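import Summits.ValiantsHypothesis.ValiantsHypothesis.Theorems.LacunarySymmetroidMatrixDescartesCensusBoundaryLift

/-!
# `MatrixDescartes` census — TAILS of alternation chains: root counts that survive a perturbation dominating only the low end

HONEST FRAMING.  Object-search cell `pub-symmetroid`, crux `Theses.LacunarySymmetroid.MatrixDescartes`
(stmt-ValiantsHypothesis-18050); this file is a HELPER of that item with no closure claim.  It is the exact «untwisting /
bump» currency asked for as W6 in the desk's rulings R1274/R1279 (theory g20's RESIDUE-READING §2(l3)): if `f` carries an
alternation chain `a₀ < ⋯ < a_N` and a perturbation `h` is dominated, `|h(aᵢ)| < |f(aᵢ)|`, at every chain point FROM INDEX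
`i₀` ON (it may dominate at the first `i₀` points — e.g. `h` = the three tiny low-order terms of a twenty near the stratum
`F₀`), then `f + h` still carries the TAIL chain `a_{i₀} < ⋯ < a_N` and hence has at least `N − i₀` distinct positive
roots (`le_card_posRoots_add_of_abs_lt_from`).  For a twenty (`N = 20`) and `i₀ = 3` this is «`g = f −` (low terms) keeps
`≥ 17` distinct positive roots», for `i₀ = 4` «`≥ 16`».  Nothing here asserts that twenties exist; nothing bounds `ζ`;
nothing bears on `MatrixDescartes` or on `VP ≠ VNP`.

[folklore] Elementary; no citation exists or is needed.
-/

-- `Summit.ValiantsHypothesis.ValiantsHypothesis.…` repeats a component by the D-0017 layout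
-- (single-conjunct summit), which the `dupNamespace` linter flags; the name is mandated.
set_option linter.dupNamespace false

open Polynomial Finset
open scoped BigOperators Polynomial

namespace Summit.ValiantsHypothesis.ValiantsHypothesis.Theorems.LacunarySymmetroidMatrixDescartes.Census

/-- **The tail of an alternation chain is an alternation chain** (anchored with the sign of `p (a_{i₀})`). [folklore] -/
theorem altChain_tail {p : ℝ[X]} {N : ℕ} {s : ℝ} {a : Fin (N + 1) → ℝ} (h : AltChain p N s a) (i₀ : ℕ)
    (hi : i₀ ≤ N) :
    AltChain p (N - i₀) (p.eval (a ⟨i₀, by omega⟩)) (fun j : Fin (N - i₀ + 1) => a ⟨i₀ + j.val, by omega⟩) := by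
  obtain ⟨hmono, ha0, halt, hanc⟩ := h
  refine ⟨?_, ?_, ?_, ?_⟩
  · intro j k hjk
    apply hmono
    rw [Fin.lt_def] at hjk ⊢
    simp only
    omega
  · simp only [Fin.val_zero, add_zero]
    exact lt_of_lt_of_le ha0 (hmono.monotone (by rw [Fin.le_def]; exact Nat.zero_le _))
  · intro j
    have hj : i₀ + j.val < N := by have := j.2; omega
    have := halt ⟨i₀ + j.val, hj⟩
    simp only [Fin.castSucc_mk, Fin.succ_mk] at this
    have e1 : (⟨i₀ + (j.castSucc).val, by have := j.2; omega⟩ : Fin (N + 1)) = ⟨i₀ + j.val, by omega⟩ := by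
      ext; simp
    have e2 : (⟨i₀ + (j.succ).val, by have := j.2; omega⟩ : Fin (N + 1)) = ⟨i₀ + j.val + 1, by omega⟩ := by
      ext; simp [Nat.add_assoc]
    simp only [e1, e2]
    exact this
  · -- anchor: `p(a_{i₀}) ≠ 0`
    have hne : p.eval (a ⟨i₀, by omega⟩) ≠ 0 := by
      rcases Nat.eq_zero_or_pos i₀ with h0 | hpos
      · subst h0
        intro h0
        have h0' : p.eval (a 0) = 0 := by simpa using h0
        rw [h0', mul_zero] at hanc; exact lt_irrefl _ hanc
      · have := halt ⟨i₀ - 1, by omega⟩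
        intro h0
        have e : (⟨i₀ - 1, by omega⟩ : Fin N).succ = ⟨i₀, by omega⟩ := by ext; simp; omega
        rw [e, h0, mul_zero] at this
        exact lt_irrefl _ this
    simp only [Fin.val_zero, add_zero]
    exact mul_self_pos.mpr hne

/-- **Root count surviving a perturbation that is dominated only from index `i₀` on**: `N − i₀` distinct positive roots of
`f + h`. [folklore] -/
theorem le_card_posRoots_add_of_abs_lt_from {f h : ℝ[X]} {N : ℕ} {s : ℝ} {a : Fin (N + 1) → ℝ}
    (hc : AltChain f N s a) (i₀ : ℕ) (hi : i₀ ≤ N)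
    (hsmall : ∀ i : Fin (N + 1), i₀ ≤ i.val → |h.eval (a i)| < |f.eval (a i)|) :
    N - i₀ ≤ ((f + h).roots.toFinset.filter (fun t => 0 < t)).card := by
  have htail := altChain_tail hc i₀ hi
  refine le_card_posRoots_add_of_abs_lt htail (fun j => hsmall _ ?_)
  simp

/-- The twenty-shaped instance quoted in RESIDUE-READING §2(l3): a chain of `21` positive points (`20` sign changes) and a
perturbation dominated from the fourth point on leave `≥ 17` distinct positive roots. [folklore] -/
theorem seventeen_le_card_posRoots_of_chain_twenty {f h : ℝ[X]} {s : ℝ} {a : Fin 21 → ℝ} (hc : AltChain f 20 s a)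
    (hsmall : ∀ i : Fin 21, 3 ≤ i.val → |h.eval (a i)| < |f.eval (a i)|) :
    17 ≤ ((f + h).roots.toFinset.filter (fun t => 0 < t)).card :=
  le_card_posRoots_add_of_abs_lt_from hc 3 (by norm_num) hsmall

end Summit.ValiantsHypothesis.ValiantsHypothesis.Theorems.LacunarySymmetroidMatrixDescartes.Census
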